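import Literature.MathematicalPhysics.QuantumLattice.FermiRG.BGM2006Sec2Expansion
import Mathlib.MeasureTheory.Integral.Lebesgue.Basic
import Mathlib.MeasureTheory.Constructions.Pi
import Mathlib.Analysis.SpecialFunctions.Log.Base
import Mathlib.Data.Nat.Factorial.Basic
import HarnessLib

/-!
# Benfatto–Giuliani–Mastropietro 2003, §2.4–§2.7 and §4: the power-counting skeleton of the tree expansion,
the exponents `z(v)` (3.64), `δ(p)` (3.67), `δ_ext(p)` (3.67a), the norms `‖·‖_{h,p}` (5.3) / `‖·‖_p` (5.3a),
the hypotheses (3.58)–(3.60) on the modified running coupling functions, and the statements Lemma 2.2 [lm3.2]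
(3.62), Theorem 2.1 [th3.1] (3.69), Theorem 4.1 [th5.1] (5.69), Lemma 4.1 [lm5.1] (5.6)–(5.7), Theorem 4.2
[th5.2] as statement SHAPES on explicit carriers — with the bookkeeping (3.66a)+(3.66b) ⇒ (3.66) PROVED

Topic `Literature/MathematicalPhysics/QuantumLattice/FermiRG`; statements-first typing (D-0069 (2) typer wave,
seat t3, wave-optional rows `BGM03.L2.2`, `BGM03.T2.1`, `BGM03.T4.1`, `BGM03.L4.1`, `BGM03.T4.2`) of

* [BGM03] G. Benfatto, A. Giuliani, V. Mastropietro, *Low temperature analysis of two-dimensional Fermi systems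
  with symmetric Fermi surface*, Ann. Henri Poincaré 4 (2003) 137–193, arXiv:cond-mat/0207210
  [BenfattoGiulianiMastropietro2003].  Locators `p.N (Ln)` = N-th 3000-character chunk (line n) of the
  materialised arXiv TeX (`lit read arxiv:cond-mat/0207210`; the chunking of `BGM2003Main` / `BGM2003Sectors`);
  equation / lemma numbers are the printed ones (TeX labels in brackets).

Companion of the frozen F3a/F3b (`BGM2003Main`, `BGM2003Sectors`) and of the sibling typing of the SAME
expansion for the 2006 Hubbard paper, `BGM2006Sec2Expansion` (seat t1, file F1b) / `BGM2006Sec2Theorem21` (F1c),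
whose pattern this file follows and two of whose exponents it REUSES (`bgmSigma`, `bgmDelta`, cited below).

## Why shapes and not named facts (class W-004 of the cell's GAP-LEDGER; gap row G-t3-03)

The SUBJECTS of the five statements are objects of the renormalised Gallavotti–Nicolò tree expansion of §2.4–§2.6:
`J_{h,n}(2l₀,q₀)` (3.48) = the sector sum, weighted by the constraints `χ_v` (3.44), of the `L¹` norm of the
modified tree values `W^{(mod)}_{τ,P,Ω,T,α}` (3.40)/(3.46); the modified running coupling functions (MRCF)
`λ̃_{h,σ}, ν̃_{h,σ}, z̃_{h,σ}` (3.46), (5.5a)–(5.5c); the localised values `W^{(L,mod)}` (5.0e); the beta function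
`β^{p,m}_h` (5.2); the solution maps `ν̃ ↦ λ̃(ν̃), z̃(ν̃)` of (5.5aa), (5.5ca) and the map `𝐓` (5.8).  None of
these is in the tree and none is built here (that IS the formalisation of the BGM expansion); exactly as for
BGM06 Theorem 2.1 (gap G-t1-1, F1c's `BGMTheorem21`), the statements are therefore typed as `Prop`-valued
PREDICATES on explicit carriers — `J : ℤ → ℕ → ℕ → ℕ → ℝ` for `(h, n, l₀, q₀) ↦ J_{h,n}(2l₀,q₀)`, families
`Λ : ℤ → SectorKernel 4`, `V Z : ℤ → SectorKernel 2` for the MRCF, maps `LamOf`, `ZOf`, `MRCF` for the solution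
maps — which a consumer instantiates with the BGM objects and ASSUMES.  No closed named fact with a fake subject
is introduced: **net debt 0** in this file.  What IS typed with bodies and PROVED is everything on the
right-hand sides: the skeleton, the exponents, the norms, and the telescoping bookkeeping.

## What is here

* **§2.4 items 1)–6)** (p.8 L93 – p.9 L47): the power-counting skeleton `BGM2003.Tree` / `BGM2003.Forest` of a
  labelled tree `τ ∈ 𝒯_{h,n}`: endpoints carry their TYPE `ν`, `z` or `λ` ((3.28)/(3.37); 2, 2, 4 external
  fields), vertices their number `p = |P_v|` of external fields and the ordered forest of subtrees one scale up
  (item 2: every vertex sits on a vertical line `h_v`, the first vertex `v₀` on `h + 1`; endpoints hang one scale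
  above the vertex preceding them, item 3).  t1's `GNTree` (BGM06) is the sub-case "all endpoints of type `λ`";
  BGM03's `ν`- and `z`-endpoints (the counterterm and the wave-function coupling are RUNNING here) need the tag.
  Derived data: `n` (`numEndpoints`), `m₄(v)` ((3.62): endpoints of type `λ` below `v`), `m₂(v)` ((3.66b): of type
  `ν` or `z`), `|P_v|` (`extLegs`), `s_v` (`Forest.len`).
* **(3.66b) PROVED** (`Tree.legDefect_eq`, `Tree.branchExcess_eq`):
  `Σ_{v ≥ ṽ, v not e.p.} (Σ_{i=1}^{s_v}|P_{v_i}| − |P_v|) = 4m₄(ṽ) + 2m₂(ṽ) − |P_ṽ|` and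
  `Σ_{v ≥ ṽ, v not e.p.} (s_v − 1) = m₄(ṽ) + m₂(ṽ) − 1`.
* **§2.7 exponents**: `z(v)` (3.64) `zExp`, `δ(p)` (3.67) `delta` (PROVED: `δ(p) < 0`, indeed `≤ −½`, for every
  even `p ≥ 2` — the remark after (3.67a), p.16 L23; and `δ(p) = bgmDelta p` of BGM06 (2.78) for even `p ≥ 6`:
  the two papers differ exactly at `p ∈ {2, 4}`, where BGM03's `ℛ` acts), `δ_ext(p)` (3.67a) `deltaExt`; the sector
  exponent `½(|P_v|−3)𝟙(4≤|P_v|≤8) + ½(|P_v|−1)𝟙(|P_v|≥10)` of (3.62) is LITERALLY BGM06 (2.83)'s `bgmSigma`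
  (reused, not re-declared).
* **Lemma 2.2 [lm3.2]**: its hypotheses (3.58)–(3.60) as the predicate `MRCFBounds` written with the norm
  `‖·‖_{h,p}` of (5.3) (the paper's own identification, p.21 L82–87: "`ν̃_{h,σ}`, `z̃_{h,σ}` are the
  `σ`-components of two functions `ν̃_h`, `z̃_h ∈ 𝓜_{h,2}`, while `λ̃_{h,σ}` is the `σ`-component of
  `λ̃_h ∈ 𝓜_{h,4}`", and (5.6) restates (3.58)/(3.60) as `‖λ̃_h‖_{h,4} ≤ 2C₁|λ|γ^{-h/2}`, `‖z̃_h‖_{h,2} ≤ C₁|λ|`),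
  and its conclusion (3.62) as the function `Tree.lemma22Bound` of the skeleton (printed statement in its
  docstring; the left-hand side is a gap object).
* **Theorem 2.1 [th3.1] (3.69)**: `theorem21Bound` = `(c|λ|)ⁿ γ^{h[−q₀ + δ_ext(2l₀)]}` and the shape
  `Theorem21Shape` on the carrier `J`; the intermediate (3.66) summand `Π_{v not e.p.} (1/s_v!) γ^{δ(|P_v|)}`
  (`Tree.vertexWeight`); and the **PROVED power counting** `Tree.powerCounting`: for every skeleton of the printed
  shape, the exponents of `γ` displayed in (3.66a) — Gram–Hadamard + tree lines
  `h_v[¾(Σ_i|P_{v_i}| − |P_v|) − 5/2(s_v − 1)]` ((3.49), (3.57)), the endpoint factors `Π_i γ^{(h_i−1)𝟙(|P(v_i)|=2)}`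
  ((3.62), (3.65)), the regularisation/sector factors `−z(v) − ½m₄(v) + σ(|P_v|)` ((3.63), (3.62)) and the root
  factor `−h[½m₄(v₀) + ½𝟙(l₀=0) + q₀]` — add up, via (3.66b), EXACTLY to `h[δ_ext(2l₀) − q₀] + Σ_{v not e.p.} δ(|P_v|)`
  of (3.66), up to the constant `γ^{5/2}` at `v₀` when `P_{v₀} = ∅` (which (3.66) absorbs into `cⁿ`; stated
  explicitly in the theorem).
* **§4**: `h_β` (3.4a) `hBeta` (PROVED: it is the largest `h ≤ 0` with `γ^{h−1}e₀ < π/β`); Theorem 4.1 [th5.1]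
  (5.69) `theorem41Bound` / `Theorem41Shape`; the norms `‖G‖_{h,p}` (5.3) `mNorm` and `‖G‖_p` (5.3a) `seqNorm`
  (in `ℝ≥0∞`, so no integrability side condition is smuggled in); Lemma 4.1 [lm5.1] (5.6)–(5.7) `Lemma41Shape`;
  Theorem 4.2 [th5.2] `Theorem42Shape`.

## Typing conventions / deviations, stated once

* `γ = 4`; scales are integers `h ≤ 1`; `|O_h| = γ^{-(h−1)/2} = 2^{1−h}` for `h ≤ 0` (p.7 L131–133) and `O₁ = {0}`
  (p.13 L140–143): `numSectors h = 2^{(1−h)}` (`= sectorCount n` at `h = −n`, proved).  `γ^{-h/2} = 2^{-h}`.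
* A vertex of the skeleton at scale `k` has its children at scale `k + 1`; trivial vertices ARE vertices
  (item 2), so endpoint scales come out right (item 3: `h_v = h_{v'} + 1`).  The root `r` (scale `h`) is not a
  vertex; a tree `τ ∈ 𝒯_{h,n}` is represented by the subtree at `v₀` together with the root scale `h`.
* `SectorKernel p` = families `G_σ(x⃗₁,…,x⃗_p)`, `σ ∈ ℕ^p` (sector indices `σ_i < |O_h|`; larger indices are never
  summed), positions in `ℝ²` ("the space coordinates are continuous variables, both in the continuum and lattice
  models", p.7 L1–2), values in `ℂ` (the paper's `𝓜_{h,p}` has real components; coerce).  The side conditions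
  defining `𝓜_{h,p}` (translation invariance; Fourier transform continuous with support in `⊗_i D_{h,σ_i}`,
  `D_{h,σ}` = the support of the unspecified envelope `F̃_{h,σ}` of (3.45aa), p.21 L62–80) constrain the GAP
  objects and enter the shapes only as explicit predicate parameters `mem` where a statement quantifies over
  elements of `𝔐_p` (Lemma 4.1's `ν̃, ν̃'`; Theorem 4.2's `ν̃₁`).
* (5.7) prints `max_{j>h} ‖ν̃_h − ν̃'_h‖_{h,2}`; it is read as in its proof (3.7d) (p.22 L36–45):
  `max_{h<j≤1} ‖ν̃_j − ν̃'_j‖_{j,2}`.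
* Unspecified constants are explicit parameters or existentially quantified in the printed order.

Nothing here asserts anything about the Hubbard model, H1, K1 or K3; no `sorry`, no axiom, no instance, no
notation; no named `Prop` fact.
-/

noncomputable section

open Real Set MeasureTheory
open scoped ENNReal

namespace Literature.MathematicalPhysics.QuantumLattice.FermiRG

namespace BGM2003

/-! ### §2.4 items 1)–6): the power-counting skeleton of `τ ∈ 𝒯_{h,n}` -/

/-- **Endpoint types** (§2.4 item 3, p.9 L1–8; (3.28), (3.37)): an endpoint of scale `h_v ≤ 1` carries one of
the three local terms `ν` (`γ^{h}ν_h ψ⁺ψ⁻`), `z` (`z_h ψ⁺∂₀ψ⁻`), `λ` (`λ_h ψ⁺ψ⁺ψ⁻ψ⁻`) of `ℒ𝒱^{(h_v−1)}`; an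
endpoint of scale `2` one of the two terms `λ` (= `𝒱`) or `ν` (= `𝒩`) of `𝒱^{(1)}` (3.1).
[cite: BenfattoGiulianiMastropietro2003, §2.4 item 3) p.9 (L1–8)] -/
inductive EndpointType : Type
  | nu
  | zeta
  | lam
  deriving DecidableEq

/-- `|P_v| = |I_v|` of an endpoint: `2` for types `ν`, `z`, `4` for type `λ` ((3.28)). [cite: BenfattoGiulianiMastropietro2003, §2.2 (3.28) p.7 (L52–72)] -/
def EndpointType.legs : EndpointType → ℕ
  | .nu => 2
  | .zeta => 2
  | .lam => 4

mutual
/-- **The power-counting skeleton of a labelled tree** `τ ∈ 𝒯_{h,n}` (§2.4 items 1)–6), p.8 L95 – p.9 L47):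
a vertex is an ENDPOINT with its type, or a (trivial or non-trivial) VERTEX `v` carrying `p = |P_v|` (the
number of its external fields, p.10 L1–21) and the ordered forest of the `s_v` subtrees rooted at the vertices
immediately following it, one scale up.  Field labels, the sets `P_v` themselves, the anchored trees `T_v`, the
labels `α ∈ A_T` are not part of the skeleton (gap G-t3-03).  t1's `GNTree` (BGM06 §2.6) is the sub-case with
`λ`-endpoints only. [cite: BenfattoGiulianiMastropietro2003, §2.4 items 1)–6) p.8 (L95) – p.9 (L47)] -/
inductive Tree : Type
  | endpt (κ : EndpointType) : Tree
  | vtx (p : ℕ) (children : Forest) : Tree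

/-- The ordered forest of the subtrees of a vertex (`s_v` = its length, (3.30)). [cite: BenfattoGiulianiMastropietro2003, §2.4 (3.30) p.9 (L54–61)] -/
inductive Forest : Type
  | nil : Forest
  | cons (t : Tree) (rest : Forest) : Forest
end

mutual
/-- `n` = the number of endpoints (the ORDER of the tree, item 1). [cite: BenfattoGiulianiMastropietro2003, §2.4 item 1) p.8 (L95–99)] -/
def Tree.numEndpoints : Tree → ℕ
  | .endpt _ => 1
  | .vtx _ cs => cs.numEndpoints

/-- Number of endpoints of a forest. [cite: BenfattoGiulianiMastropietro2003, §2.4 item 1) p.8 (L95–99)] -/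
def Forest.numEndpoints : Forest → ℕ
  | .nil => 0
  | .cons t f => t.numEndpoints + f.numEndpoints
end

mutual
/-- `m₄(v)` = "the number of endpoints of type `λ` following the vertex `v`" ((3.62), p.15 L85–86), for the
subtree at `v`. [cite: BenfattoGiulianiMastropietro2003, §2.7 (3.62) p.15 (L85–86)] -/
def Tree.m₄ : Tree → ℕ
  | .endpt .lam => 1
  | .endpt .nu => 0
  | .endpt .zeta => 0
  | .vtx _ cs => cs.m₄

/-- `m₄` of a forest. [cite: BenfattoGiulianiMastropietro2003, §2.7 (3.62) p.15 (L85–86)] -/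
def Forest.m₄ : Forest → ℕ
  | .nil => 0
  | .cons t f => t.m₄ + f.m₄
end

mutual
/-- `m₂(v)` = "the number of endpoints of type `ν` or `z` following `v`" ((3.66b), p.15 L149–150). [cite: BenfattoGiulianiMastropietro2003, §2.7 (3.66b) p.15 (L149–150)] -/
def Tree.m₂ : Tree → ℕ
  | .endpt .lam => 0
  | .endpt .nu => 1
  | .endpt .zeta => 1
  | .vtx _ cs => cs.m₂

/-- `m₂` of a forest. [cite: BenfattoGiulianiMastropietro2003, §2.7 (3.66b) p.15 (L149–150)] -/
def Forest.m₂ : Forest → ℕ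
  | .nil => 0
  | .cons t f => t.m₂ + f.m₂
end

/-- `|P_v|` of the root of a (sub)tree: `p` for a vertex, `2`/`2`/`4` for an endpoint of type `ν`/`z`/`λ`
(`P_v = I_v` for endpoints, p.10 L5–6). [cite: BenfattoGiulianiMastropietro2003, §2.4 p.10 (L1–6)] -/
def Tree.extLegs : Tree → ℕ
  | .endpt κ => κ.legs
  | .vtx p _ => p

/-- `s_v` = the number of subtrees of a vertex. [cite: BenfattoGiulianiMastropietro2003, §2.4 (3.30) p.9 (L54–61)] -/
def Forest.len : Forest → ℕ
  | .nil => 0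
  | .cons _ f => f.len + 1

/-- `Σ_{i=1}^{s_v} |P_{v_i}|` over the roots of a forest ((3.49)). [cite: BenfattoGiulianiMastropietro2003, §2.7 (3.49) p.14 (L93–100)] -/
def Forest.sumExtLegs : Forest → ℕ
  | .nil => 0
  | .cons t f => t.extLegs + f.sumExtLegs

mutual
/-- `n = m₄ + m₂`: every endpoint is of type `λ` or of type `ν`/`z`. [cite: BenfattoGiulianiMastropietro2003, §2.4 item 3) p.9 (L1–8)] -/
theorem Tree.numEndpoints_eq : ∀ t : Tree, t.numEndpoints = t.m₄ + t.m₂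
  | .endpt .lam => rfl
  | .endpt .nu => rfl
  | .endpt .zeta => rfl
  | .vtx _ cs => Forest.numEndpoints_eq cs

/-- Forest version of `Tree.numEndpoints_eq`. [cite: BenfattoGiulianiMastropietro2003, §2.4 item 3) p.9 (L1–8)] -/
theorem Forest.numEndpoints_eq : ∀ f : Forest, f.numEndpoints = f.m₄ + f.m₂
  | .nil => rfl
  | .cons t f => by
      rw [Forest.numEndpoints, Forest.m₄, Forest.m₂, Tree.numEndpoints_eq t, Forest.numEndpoints_eq f]
      ring
end

/-! ### (3.66b): the two counting identities of the tree expansion (proved) -/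

mutual
/-- `Σ_{v ≥ ṽ, v not e.p.} (Σ_{i=1}^{s_v} |P_{v_i}| − |P_v|)` for the subtree at `ṽ` — the exponent sum of the
Gram–Hadamard bound (3.49), left-hand side of the first identity (3.66b). [cite: BenfattoGiulianiMastropietro2003, §2.7 (3.66b) p.16 (L1–5)] -/
def Tree.legDefect : Tree → ℤ
  | .endpt _ => 0
  | .vtx p cs => ((cs.sumExtLegs : ℤ) - p) + cs.legDefect

/-- The same sum over a forest. [cite: BenfattoGiulianiMastropietro2003, §2.7 (3.66b) p.16 (L1–5)] -/
def Forest.legDefect : Forest → ℤ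
  | .nil => 0
  | .cons t f => t.legDefect + f.legDefect
end

mutual
/-- `Σ_{v ≥ ṽ, v not e.p.} (s_v − 1)` — left-hand side of the second identity (3.66b) (the number of tree lines,
(3.57)). [cite: BenfattoGiulianiMastropietro2003, §2.7 (3.66b) p.16 (L1–5)] -/
def Tree.branchExcess : Tree → ℤ
  | .endpt _ => 0
  | .vtx _ cs => ((cs.len : ℤ) - 1) + cs.branchExcess

/-- The same sum over a forest. [cite: BenfattoGiulianiMastropietro2003, §2.7 (3.66b) p.16 (L1–5)] -/
def Forest.branchExcess : Forest → ℤ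
  | .nil => 0
  | .cons t f => t.branchExcess + f.branchExcess
end

mutual
/-- **(3.66b), first identity**: `Σ_{v ≥ ṽ, v not e.p.} (Σ_i |P_{v_i}| − |P_v|) = 4m₄(ṽ) + 2m₂(ṽ) − |P_ṽ|`
(telescoping: every endpoint of type `λ` contributes its 4 fields, of type `ν`/`z` its 2). PROVED for every
skeleton (for an endpoint both sides vanish). [cite: BenfattoGiulianiMastropietro2003, §2.7 (3.66b) p.16 (L1–5)] -/
theorem Tree.legDefect_eq : ∀ t : Tree, t.legDefect = 4 * (t.m₄ : ℤ) + 2 * (t.m₂ : ℤ) - (t.extLegs : ℤ)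
  | .endpt .lam => by simp [Tree.legDefect, Tree.m₄, Tree.m₂, Tree.extLegs, EndpointType.legs]
  | .endpt .nu => by simp [Tree.legDefect, Tree.m₄, Tree.m₂, Tree.extLegs, EndpointType.legs]
  | .endpt .zeta => by simp [Tree.legDefect, Tree.m₄, Tree.m₂, Tree.extLegs, EndpointType.legs]
  | .vtx p cs => by
      have ih := Forest.legDefect_eq cs
      simp only [Tree.legDefect, Tree.m₄, Tree.m₂, Tree.extLegs] at ih ⊢
      linarith

/-- Forest version: `Σ = 4m₄ + 2m₂ − Σ_i |P_{v_i}|`. [cite: BenfattoGiulianiMastropietro2003, §2.7 (3.66b) p.16 (L1–5)] -/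
theorem Forest.legDefect_eq : ∀ f : Forest,
    f.legDefect = 4 * (f.m₄ : ℤ) + 2 * (f.m₂ : ℤ) - (f.sumExtLegs : ℤ)
  | .nil => by simp [Forest.legDefect, Forest.m₄, Forest.m₂, Forest.sumExtLegs]
  | .cons t f => by
      have iht := Tree.legDefect_eq t
      have ihf := Forest.legDefect_eq f
      simp only [Forest.legDefect, Forest.m₄, Forest.m₂, Forest.sumExtLegs, Nat.cast_add] at *
      linarith
end

mutual
/-- **(3.66b), second identity**: `Σ_{v ≥ ṽ, v not e.p.} (s_v − 1) = m₄(ṽ) + m₂(ṽ) − 1` (= `n(ṽ) − 1`: a tree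
with `n` leaves has `n − 1` more edges than internal vertices). PROVED for every skeleton. [cite: BenfattoGiulianiMastropietro2003, §2.7 (3.66b) p.16 (L1–5)] -/
theorem Tree.branchExcess_eq : ∀ t : Tree, t.branchExcess = (t.m₄ : ℤ) + (t.m₂ : ℤ) - 1
  | .endpt .lam => by simp [Tree.branchExcess, Tree.m₄, Tree.m₂]
  | .endpt .nu => by simp [Tree.branchExcess, Tree.m₄, Tree.m₂]
  | .endpt .zeta => by simp [Tree.branchExcess, Tree.m₄, Tree.m₂]
  | .vtx p cs => by
      have ih := Forest.branchExcess_eq cs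
      simp only [Tree.branchExcess, Tree.m₄, Tree.m₂] at ih ⊢
      linarith

/-- Forest version: `Σ = m₄ + m₂ − (number of trees)`. [cite: BenfattoGiulianiMastropietro2003, §2.7 (3.66b) p.16 (L1–5)] -/
theorem Forest.branchExcess_eq : ∀ f : Forest, f.branchExcess = (f.m₄ : ℤ) + (f.m₂ : ℤ) - (f.len : ℤ)
  | .nil => by simp [Forest.branchExcess, Forest.m₄, Forest.m₂, Forest.len]
  | .cons t f => by
      have iht := Tree.branchExcess_eq t
      have ihf := Forest.branchExcess_eq f
      simp only [Forest.branchExcess, Forest.m₄, Forest.m₂, Forest.len, Nat.cast_add, Nat.cast_one] at *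
      linarith
end

/-! ### §2.7: the exponents `z(v)` (3.64), `δ(p)` (3.67), `δ_ext(p)` (3.67a) -/

/-- **(3.64)** `z(v) = 2` if `|P_v| = 2`, `1` if `|P_v| = 4`, `0` otherwise — the gain of the `ℛ` operation at a
vertex, (3.63). [cite: BenfattoGiulianiMastropietro2003, §2.7 (3.63)–(3.64) p.15 (L113–119)] -/
def zExp (p : ℕ) : ℕ := if p = 2 then 2 else if p = 4 then 1 else 0

/-- **(3.67)** `δ(p) = −𝟙(2 ≤ p ≤ 4) + (1 − p/4)𝟙(6 ≤ p ≤ 8) + (2 − p/4)𝟙(p ≥ 10)`, the scaling exponent of a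
cluster with `p = |P_v|` external fields in (3.66). [cite: BenfattoGiulianiMastropietro2003, §2.7 (3.67) p.16 (L15–19)] -/
def delta (p : ℕ) : ℝ :=
  (if 2 ≤ p ∧ p ≤ 4 then -1 else 0) + (if 6 ≤ p ∧ p ≤ 8 then 1 - (p : ℝ) / 4 else 0) +
    (if 10 ≤ p then 2 - (p : ℝ) / 4 else 0)

/-- **(3.67a)** `δ_ext(p) = 5/2 − ¾p − ½𝟙(p = 0)`, the external-leg exponent of (3.66)/(3.69)/(5.69).
[cite: BenfattoGiulianiMastropietro2003, §2.7 (3.67a) p.16 (L21)] -/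
def deltaExt (p : ℕ) : ℝ := 5 / 2 - 3 / 4 * (p : ℝ) - if p = 0 then 1 / 2 else 0

/-- The printed values `δ(2) = δ(4) = −1`, `δ(6) = −½`, `δ(8) = −1`, `δ(10) = −½`; `δ_ext(0) = 2`, `δ_ext(2) = 1`,
`δ_ext(4) = −½`. [cite: BenfattoGiulianiMastropietro2003, §2.7 (3.67)–(3.67a) p.16 (L15–21)] -/
theorem delta_values : delta 2 = -1 ∧ delta 4 = -1 ∧ delta 6 = -1 / 2 ∧ delta 8 = -1 ∧ delta 10 = -1 / 2 ∧
    deltaExt 0 = 2 ∧ deltaExt 2 = 1 ∧ deltaExt 4 = -1 / 2 := by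
  refine ⟨?_, ?_, ?_, ?_, ?_, ?_, ?_, ?_⟩ <;> norm_num [delta, deltaExt]

/-- **Remark after (3.67a)** (p.16 L23): "`δ(|P_v|) < 0` for any vertex `v` which is not an endpoint" — indeed
`δ(p) ≤ −½` for every even `p ≥ 2` (hence the sum over trees (3.68) converges, "a standard argument, see [BM] or
[GM]"). [cite: BenfattoGiulianiMastropietro2003, §2.7 remark after (3.67a) and (3.68) p.16 (L23–29)] -/
theorem delta_le_neg_half {p : ℕ} (hp : Even p) (h2 : 2 ≤ p) : delta p ≤ -1 / 2 := by
  obtain ⟨r, rfl⟩ := hp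
  by_cases hr : r ≤ 4
  · have h1 : 1 ≤ r := by omega
    interval_cases r <;> norm_num [delta]
  · have hA : ¬(2 ≤ r + r ∧ r + r ≤ 4) := by omega
    have hB : ¬(6 ≤ r + r ∧ r + r ≤ 8) := by omega
    have hC : 10 ≤ r + r := by omega
    have hC' : (10 : ℝ) ≤ ((r + r : ℕ) : ℝ) := by exact_mod_cast hC
    simp only [delta, if_neg hA, if_neg hB, if_pos hC]
    linarith

/-- `δ(0) = 0` ((3.67): no indicator applies at `p = 0`). [cite: BenfattoGiulianiMastropietro2003, §2.7 (3.67) p.16 (L15–19)] -/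
theorem delta_zero : delta 0 = 0 := by
  norm_num [delta]

/-- `δ(p) < 0` for every even `p ≥ 2` (the printed remark). [cite: BenfattoGiulianiMastropietro2003, §2.7 remark after (3.67a) p.16 (L23)] -/
theorem delta_neg {p : ℕ} (hp : Even p) (h2 : 2 ≤ p) : delta p < 0 :=
  lt_of_le_of_lt (delta_le_neg_half hp h2) (by norm_num)

/-- BGM03's `δ` (3.67) and BGM06's `δ` (2.78) (`bgmDelta`, `BGM2006Sec2Expansion`) AGREE for every even
`p ≥ 6` (the leg numbers that occur); they differ at `p ∈ {2, 4}` (`−1` here versus `½`, `0`), where in BGM03 the `ℛ` operation acts ((3.63)–(3.64)) while in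
BGM06 two-leg clusters are excluded and four-leg ones are endpoints. [cite: BenfattoGiulianiMastropietro2003, §2.7 (3.67) p.16 (L15–19)] -/
theorem delta_eq_bgmDelta {p : ℕ} (hp : Even p) (h6 : 6 ≤ p) : delta p = bgmDelta p := by
  unfold delta bgmDelta
  have hA : ¬(2 ≤ p ∧ p ≤ 4) := by omega
  rw [if_neg hA]
  by_cases h8 : p ≤ 8
  · have hB : 6 ≤ p ∧ p ≤ 8 := ⟨h6, h8⟩
    have hC : ¬(10 ≤ p) := by omega
    rw [if_pos hB, if_neg hC, if_neg hC]; ring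
  · have hB : ¬(6 ≤ p ∧ p ≤ 8) := fun h => h8 h.2
    have hC : 10 ≤ p := by obtain ⟨r, rfl⟩ := hp; omega
    rw [if_neg hB, if_pos hC, if_pos hC]; ring

/-- The per-vertex exponent produced by the proof of Theorem 2.1 BEFORE the case analysis (3.67):
`δ̃(p) = 5/2 − ¾p − z(p) + σ(p)`, `σ` = the sector exponent of (3.62) (= BGM06 (2.83)'s `bgmSigma`):
the four contributions (3.49)+(3.57) (`5/2 − ¾p` after (3.66b)), (3.63) (`−z`), (3.62) (`σ`).  It equals
`δ(p)` for every even `p ≥ 2` (`deltaAux_eq_delta`) and `5/2` at `p = 0`. [cite: BenfattoGiulianiMastropietro2003, §2.7 (3.66a)–(3.67) p.15 (L137) – p.16 (L21)] -/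
def deltaAux (p : ℕ) : ℝ := 5 / 2 - 3 / 4 * (p : ℝ) - (zExp p : ℝ) + bgmSigma p

/-- `δ̃(p) = δ(p)` for even `p ≥ 2` — the case analysis behind (3.67). [cite: BenfattoGiulianiMastropietro2003, §2.7 (3.66a)–(3.67) p.15 (L137) – p.16 (L21)] -/
theorem deltaAux_eq_delta {p : ℕ} (hp : Even p) (h2 : 2 ≤ p) : deltaAux p = delta p := by
  obtain ⟨r, rfl⟩ := hp
  by_cases hr : r ≤ 4
  · have h1 : 1 ≤ r := by omega
    interval_cases r <;> norm_num [deltaAux, delta, zExp, bgmSigma]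
  · have hA : ¬(2 ≤ r + r ∧ r + r ≤ 4) := by omega
    have hB : ¬(6 ≤ r + r ∧ r + r ≤ 8) := by omega
    have hC : 10 ≤ r + r := by omega
    have hD : r + r ≠ 2 := by omega
    have hE : r + r ≠ 4 := by omega
    have hF : ¬(4 ≤ r + r ∧ r + r ≤ 8) := by omega
    simp only [deltaAux, delta, zExp, bgmSigma, if_neg hA, if_neg hB, if_pos hC, if_neg hD, if_neg hE,
      if_neg hF, Nat.cast_zero]
    ring

/-- `δ̃(0) = 5/2` (the vertex `v₀` of a free-energy tree, `P_{v₀} = ∅`). [cite: BenfattoGiulianiMastropietro2003, §2.7 (3.66a)–(3.67) p.15 (L137) – p.16 (L21)] -/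
theorem deltaAux_zero : deltaAux 0 = 5 / 2 := by
  norm_num [deltaAux, zExp, bgmSigma]

/-! ### (3.66a): the exponents of `γ` of the proof of Theorem 2.1, on the skeleton -/

mutual
/-- **(3.66a), Gram–Hadamard and tree-line factors**: `Σ_{v not e.p.} h_v[¾(Σ_{i=1}^{s_v}|P_{v_i}| − |P_v|) − 5/2(s_v − 1)]`
((3.49) contributes `¾h_v(Σ|P_{v_i}| − |P_v| − 2(s_v−1))`, (3.57) contributes `−h_v(s_v−1)`), for the subtree
whose root vertex sits at scale `k` (children at `k + 1`). [cite: BenfattoGiulianiMastropietro2003, §2.7 (3.49), (3.57), (3.66a) p.14 (L93–100), p.15 (L33–38, L137–147)] -/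
def Tree.gramLineExp : Tree → ℤ → ℝ
  | .endpt _, _ => 0
  | .vtx p cs, k =>
      (k : ℝ) * (3 / 4 * ((cs.sumExtLegs : ℝ) - (p : ℝ)) - 5 / 2 * ((cs.len : ℝ) - 1)) + cs.gramLineExp (k + 1)

/-- (3.66a) Gram/line exponent over a forest whose roots sit at scale `k`. [cite: BenfattoGiulianiMastropietro2003, §2.7 (3.66a) p.15 (L137–147)] -/
def Forest.gramLineExp : Forest → ℤ → ℝ
  | .nil, _ => 0
  | .cons t f, k => t.gramLineExp k + f.gramLineExp k
end

mutual
/-- **Endpoint scale factors** `Σ_{i : type(v*_i) ∈ S} (h_i − 1)` over the endpoints `v*_i` (scale `h_i`) of the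
subtree at scale `k`: with `S = {ν}` the factor `Π_i γ^{(h_i−1)𝟙(v is of type ν)}` of (3.62), with `S = {z}` that of
(3.65), with `S = {ν, z}` the factor `Π_i γ^{(h_i−1)𝟙(|P(v_i)|=2)}` of (3.66a) (the endpoint kernels of type `ν`/`z`
carry `γ^{h_i−1}` resp. a `∂₀` contracted on scale `h_i − 1`, (3.37)). [cite: BenfattoGiulianiMastropietro2003, §2.7 (3.62), (3.65), (3.66a) p.15 (L73–86, L121–147)] -/
def Tree.endptExp (S : Finset EndpointType) : Tree → ℤ → ℝ
  | .endpt κ, k => if κ ∈ S then (k : ℝ) - 1 else 0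
  | .vtx _ cs, k => cs.endptExp S (k + 1)

/-- Endpoint scale factors over a forest at scale `k`. [cite: BenfattoGiulianiMastropietro2003, §2.7 (3.66a) p.15 (L137–147)] -/
def Forest.endptExp (S : Finset EndpointType) : Forest → ℤ → ℝ
  | .nil, _ => 0
  | .cons t f, k => t.endptExp S k + f.endptExp S k
end

mutual
/-- **(3.62), per-vertex sector factors**: `Σ_{v not e.p.} [−½m₄(v) + σ(|P_v|)]`, `σ(p) = ½(p−3)𝟙(4≤p≤8) + ½(p−1)𝟙(p≥10)`
(= `bgmSigma`, BGM06 (2.83)); the root factor `γ^{-½h[m₄(v₀) + 𝟙(P_{v₀}=∅)]}` of (3.62) is in `Tree.rootExp`.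
[cite: BenfattoGiulianiMastropietro2003, §2.7 (3.62) p.15 (L73–86)] -/
def Tree.sectorVertexExp : Tree → ℝ
  | .endpt _ => 0
  | .vtx p cs => -(1 / 2 * ((Tree.vtx p cs).m₄ : ℝ)) + bgmSigma p + cs.sectorVertexExp

/-- (3.62) per-vertex sector factors over a forest. [cite: BenfattoGiulianiMastropietro2003, §2.7 (3.62) p.15 (L73–86)] -/
def Forest.sectorVertexExp : Forest → ℝ
  | .nil => 0
  | .cons t f => t.sectorVertexExp + f.sectorVertexExp
end

mutual
/-- **(3.63)**: `Σ_{v not e.p.} z(v)` — the regularisation gains `Π_v γ^{−z(v)}`. [cite: BenfattoGiulianiMastropietro2003, §2.7 (3.63)–(3.64) p.15 (L113–119)] -/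
def Tree.zSum : Tree → ℝ
  | .endpt _ => 0
  | .vtx p cs => (zExp p : ℝ) + cs.zSum

/-- (3.63) over a forest. [cite: BenfattoGiulianiMastropietro2003, §2.7 (3.63)–(3.64) p.15 (L113–119)] -/
def Forest.zSum : Forest → ℝ
  | .nil => 0
  | .cons t f => t.zSum + f.zSum
end

/-- **The root factor of (3.66a)**: `γ^{−h[½m₄(v₀) + ½𝟙(l₀ = 0) + q₀]}` (from (3.62)'s `γ^{-½h[m₄(v₀)+𝟙(P_{v₀}=∅)]}` and
(3.62b)'s `γ^{−hq₀}`), `|P_{v₀}| = 2l₀`. [cite: BenfattoGiulianiMastropietro2003, §2.7 (3.62b), (3.66a) p.15 (L110–111, L137–140)] -/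
def Tree.rootExp (t : Tree) (h : ℤ) (q₀ : ℕ) : ℝ :=
  -((h : ℝ) * (1 / 2 * (t.m₄ : ℝ) + (if t.extLegs = 0 then 1 / 2 else 0) + (q₀ : ℝ)))

mutual
/-- `Σ_{v not e.p.} δ(|P_v|)` over the non-endpoint vertices of a (sub)tree ((3.66)). [cite: BenfattoGiulianiMastropietro2003, §2.7 (3.66) p.16 (L9–13)] -/
def Tree.deltaSum : Tree → ℝ
  | .endpt _ => 0
  | .vtx p cs => delta p + cs.deltaSum

/-- `Σ δ` over a forest. [cite: BenfattoGiulianiMastropietro2003, §2.7 (3.66) p.16 (L9–13)] -/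
def Forest.deltaSum : Forest → ℝ
  | .nil => 0
  | .cons t f => t.deltaSum + f.deltaSum
end

mutual
/-- `Σ_{v not e.p.} δ̃(|P_v|)` (the exponent sum before the case analysis (3.67)). [cite: BenfattoGiulianiMastropietro2003, §2.7 (3.66a)–(3.67) p.15 (L137) – p.16 (L21)] -/
def Tree.deltaAuxSum : Tree → ℝ
  | .endpt _ => 0
  | .vtx p cs => deltaAux p + cs.deltaAuxSum

/-- `Σ δ̃` over a forest. [cite: BenfattoGiulianiMastropietro2003, §2.7 (3.66a)–(3.67) p.15 (L137) – p.16 (L21)] -/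
def Forest.deltaAuxSum : Forest → ℝ
  | .nil => 0
  | .cons t f => t.deltaAuxSum + f.deltaAuxSum
end

mutual
/-- **The printed shape of the part of a tree strictly below a vertex**: every non-endpoint vertex has an EVEN
number `|P_v| ≥ 2` of external fields (an odd monomial has zero truncated expectation; a cluster with
`P_v = ∅` strictly above `v₀` does not occur — its constant is collected in `Ẽ_{h_v}`, (3.29), and
`𝒱^{(h)}(0) = 0`, p.6 L103). [cite: BenfattoGiulianiMastropietro2003, §2.4 (3.29) and p.10 (L1–10)] -/
def Tree.AdmissibleBelow : Tree → Prop
  | .endpt _ => True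
  | .vtx p cs => Even p ∧ 2 ≤ p ∧ cs.AdmissibleBelow

/-- `AdmissibleBelow` for every tree of a forest. [cite: BenfattoGiulianiMastropietro2003, §2.4 (3.29) and p.10 (L1–10)] -/
def Forest.AdmissibleBelow : Forest → Prop
  | .nil => True
  | .cons t f => t.AdmissibleBelow ∧ f.AdmissibleBelow
end

mutual
/-- The telescoping invariant behind (3.66a) ⇒ (3.66) (Abel summation of the scales along the tree, using
(3.66b) at every vertex): for a subtree whose root sits at scale `k`,
`G + E_{ν,z} − Z + S = (k−1)[¾(4m₄ + 2m₂ − |P|) − 5/2(m₄ + m₂ − 1) + m₂] + Σ_{v not e.p.} δ̃(|P_v|)` — the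
endpoint scales cancel against `Σ_v m₂(v)`. [cite: BenfattoGiulianiMastropietro2003, §2.7 proof of Theorem 2.1 (3.66a)–(3.66) p.15 (L133) – p.16 (L13)] -/
theorem Tree.exponent_invariant : ∀ (t : Tree) (k : ℤ),
    t.gramLineExp k + t.endptExp {EndpointType.nu, EndpointType.zeta} k - t.zSum + t.sectorVertexExp =
      ((k : ℝ) - 1) * (3 / 4 * (4 * (t.m₄ : ℝ) + 2 * (t.m₂ : ℝ) - (t.extLegs : ℝ)) -
          5 / 2 * ((t.m₄ : ℝ) + (t.m₂ : ℝ) - 1) + (t.m₂ : ℝ)) + t.deltaAuxSum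
  | .endpt .lam, k => by
      simp [Tree.gramLineExp, Tree.endptExp, Tree.zSum, Tree.sectorVertexExp, Tree.m₄, Tree.m₂, Tree.extLegs,
        EndpointType.legs, Tree.deltaAuxSum]
  | .endpt .nu, k => by
      simp [Tree.gramLineExp, Tree.endptExp, Tree.zSum, Tree.sectorVertexExp, Tree.m₄, Tree.m₂, Tree.extLegs,
        EndpointType.legs, Tree.deltaAuxSum]
  | .endpt .zeta, k => by
      simp [Tree.gramLineExp, Tree.endptExp, Tree.zSum, Tree.sectorVertexExp, Tree.m₄, Tree.m₂, Tree.extLegs,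
        EndpointType.legs, Tree.deltaAuxSum]
  | .vtx p cs, k => by
      have ih := Forest.exponent_invariant cs (k + 1)
      simp only [Tree.gramLineExp, Tree.endptExp, Tree.zSum, Tree.sectorVertexExp, Tree.m₄, Tree.m₂,
        Tree.extLegs, Tree.deltaAuxSum, deltaAux, Int.cast_add, Int.cast_one] at ih ⊢
      linarith

/-- The invariant summed over a forest whose roots sit at scale `k`. [cite: BenfattoGiulianiMastropietro2003, §2.7 proof of Theorem 2.1 (3.66a)–(3.66) p.15 (L133) – p.16 (L13)] -/
theorem Forest.exponent_invariant : ∀ (f : Forest) (k : ℤ),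
    f.gramLineExp k + f.endptExp {EndpointType.nu, EndpointType.zeta} k - f.zSum + f.sectorVertexExp =
      ((k : ℝ) - 1) * (3 / 4 * (4 * (f.m₄ : ℝ) + 2 * (f.m₂ : ℝ) - (f.sumExtLegs : ℝ)) -
          5 / 2 * ((f.m₄ : ℝ) + (f.m₂ : ℝ) - (f.len : ℝ)) + (f.m₂ : ℝ)) + f.deltaAuxSum
  | .nil, k => by
      simp [Forest.gramLineExp, Forest.endptExp, Forest.zSum, Forest.sectorVertexExp, Forest.m₄, Forest.m₂,
        Forest.sumExtLegs, Forest.len, Forest.deltaAuxSum]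
  | .cons t f, k => by
      have iht := Tree.exponent_invariant t k
      have ihf := Forest.exponent_invariant f k
      simp only [Forest.gramLineExp, Forest.endptExp, Forest.zSum, Forest.sectorVertexExp, Forest.m₄,
        Forest.m₂, Forest.sumExtLegs, Forest.len, Forest.deltaAuxSum, Nat.cast_add, Nat.cast_one] at *
      linarith
end

mutual
/-- Below `v₀`, `Σ δ̃ = Σ δ` (every vertex there has even `|P_v| ≥ 2`). [cite: BenfattoGiulianiMastropietro2003, §2.7 (3.66)–(3.67) p.16 (L9–21)] -/
theorem Tree.deltaAuxSum_eq : ∀ {t : Tree}, t.AdmissibleBelow → t.deltaAuxSum = t.deltaSum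
  | .endpt _, _ => rfl
  | .vtx _ _, h => by
      rw [Tree.deltaAuxSum, Tree.deltaSum, deltaAux_eq_delta h.1 h.2.1, Forest.deltaAuxSum_eq h.2.2]

/-- Forest version of `Tree.deltaAuxSum_eq`. [cite: BenfattoGiulianiMastropietro2003, §2.7 (3.66)–(3.67) p.16 (L9–21)] -/
theorem Forest.deltaAuxSum_eq : ∀ {f : Forest}, f.AdmissibleBelow → f.deltaAuxSum = f.deltaSum
  | .nil, _ => rfl
  | .cons _ _, h => by
      rw [Forest.deltaAuxSum, Forest.deltaSum, Tree.deltaAuxSum_eq h.1, Forest.deltaAuxSum_eq h.2]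
end

/-- **Theorem 2.1, the power counting (3.66a) ⇒ (3.66), PROVED on the skeleton.**  For a tree `τ ∈ 𝒯_{h,n}` of
the printed shape — first vertex `v₀` at scale `h + 1` with an even number `|P_{v₀}| = 2l₀` of external fields,
every non-endpoint vertex below it with even `|P_v| ≥ 2` — the exponents of `γ` displayed in (3.66a) (Gram–Hadamard
and tree lines `h_v[¾(Σ_i|P_{v_i}| − |P_v|) − 5/2(s_v−1)]`, endpoint factors `Π_i γ^{(h_i−1)𝟙(|P(v_i)|=2)}`,
regularisation and sector factors `−z(v) − ½m₄(v) + σ(|P_v|)`, root factor `−h[½m₄(v₀) + ½𝟙(l₀=0) + q₀]`) add up,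
by (3.66b), EXACTLY to `h[δ_ext(2l₀) − q₀] + Σ_{v not e.p.} δ(|P_v|)` — the exponent of (3.66) — plus the constant
`5/2` at `v₀` when `P_{v₀} = ∅` (free-energy trees: there `δ̃(0) = 5/2` while (3.67) sets `δ(0) = 0`; (3.66)
absorbs the constant `γ^{5/2}` into `cⁿ`).  ("which, together with (3.66a) imply that (3.66)", p.16 L7.)
[cite: BenfattoGiulianiMastropietro2003, §2.7 proof of Theorem 2.1 (3.66a)–(3.66) p.15 (L133) – p.16 (L13)] -/
theorem Tree.powerCounting (p₀ : ℕ) (cs : Forest) (hcs : cs.AdmissibleBelow) (hp₀ : Even p₀) (h : ℤ) (q₀ : ℕ) :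
    (Tree.vtx p₀ cs).gramLineExp (h + 1) + (Tree.vtx p₀ cs).endptExp {EndpointType.nu, EndpointType.zeta} (h + 1)
        - (Tree.vtx p₀ cs).zSum + (Tree.vtx p₀ cs).sectorVertexExp + (Tree.vtx p₀ cs).rootExp h q₀ =
      (h : ℝ) * (deltaExt p₀ - (q₀ : ℝ)) + (Tree.vtx p₀ cs).deltaSum + (if p₀ = 0 then 5 / 2 else 0) := by
  have hinv := Tree.exponent_invariant (Tree.vtx p₀ cs) (h + 1)
  have hcs' := Forest.deltaAuxSum_eq hcs
  simp only [Int.cast_add, Int.cast_one, Tree.m₄, Tree.m₂, Tree.extLegs, Tree.deltaAuxSum] at hinv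
  simp only [Tree.rootExp, Tree.m₄, Tree.extLegs, Tree.deltaSum, deltaExt]
  rw [hinv, hcs']
  split_ifs with hp
  · subst hp
    rw [deltaAux_zero, delta_zero]
    push_cast
    ring
  · have h2 : 2 ≤ p₀ := by obtain ⟨r, hr⟩ := hp₀; omega
    rw [deltaAux_eq_delta hp₀ h2]
    ring

mutual
/-- `Π_{v not e.p.} (1/s_v!) γ^{δ(|P_v|)}` (`γ = 4`) — the summand of (3.66)/(3.68) as a function of the skeleton.
[cite: BenfattoGiulianiMastropietro2003, §2.7 (3.66), (3.68) p.16 (L9–29)] -/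
def Tree.vertexWeight : Tree → ℝ
  | .endpt _ => 1
  | .vtx p cs => (1 / (cs.len.factorial : ℝ)) * (4 : ℝ) ^ delta p * cs.vertexWeight

/-- The same product over a forest. [cite: BenfattoGiulianiMastropietro2003, §2.7 (3.66), (3.68) p.16 (L9–29)] -/
def Forest.vertexWeight : Forest → ℝ
  | .nil => 1
  | .cons t f => t.vertexWeight * f.vertexWeight
end

/-! ### The sector counts `|O_h|` and the norms (5.3), (5.3a) -/

/-- **`|O_h|`** for `h ≤ 1`: `O_h = {0, 1, …, γ^{-(h−1)/2} − 1}` for `h ≤ 0` (`γ = 4`, p.7 L131–133), i.e.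
`2^{1−h}` sectors, and the single index `O₁ = {0}` at `h = 1` (p.10 L13–14, p.13 L140–143). [cite: BenfattoGiulianiMastropietro2003, §2.3 (3.14a) p.7 (L131–137)] -/
def numSectors (h : ℤ) : ℕ := 2 ^ (1 - h).toNat

/-- At `h = −n` this is the tree's `sectorCount n = 2^{n+1}`. [cite: BenfattoGiulianiMastropietro2003, §2.3 (3.14a) p.7 (L131–137)] -/
theorem numSectors_neg (n : ℕ) : numSectors (-(n : ℤ)) = sectorCount n := by
  rw [numSectors, sectorCount, show (1 : ℤ) - -(n : ℤ) = ((n + 1 : ℕ) : ℤ) by push_cast; ring, Int.toNat_natCast]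

/-- `O₁ = {0}`. [cite: BenfattoGiulianiMastropietro2003, §2.6 p.13 (L140–143)] -/
theorem numSectors_one : numSectors 1 = 1 := by
  simp [numSectors]

/-- **Sector-labelled kernels of `p` spatial arguments**: families `σ ↦ (x⃗₁,…,x⃗_p) ↦ G_σ(x⃗)`, `σ ∈ ℕ^p` the
sector indices (`σ_i ∈ O_h`, i.e. `σ_i < |O_h|`; larger indices are never summed), the carrier of the spaces
`𝓜_{h,p}` of §4.2 (p.21 L65–87) — the MRCF `λ̃_h` (`p = 4`), `ν̃_h`, `z̃_h` (`p = 2`) are such families. [cite: BenfattoGiulianiMastropietro2003, §4.2 p.21 (L62–87)] -/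
abbrev SectorKernel (p : ℕ) : Type := (Fin p → ℕ) → (Fin p → (Fin 2 → ℝ)) → ℂ

/-- **(5.3)** the norm `‖G‖_{h,p} = sup_{i, σ_i ∈ O_h; j, x⃗_j ∈ ℝ²} Σ_{σ∖σ_i ∈ O_h^{p−1}} ∫ d(x⃗∖x⃗_j) |G_σ(x⃗)|` on
kernels of `p = k + 1` arguments with `N = |O_h|` sectors: ONE sector index (leg `i`) and ONE position (leg `j`,
independently) held fixed, the other sector indices summed, the other positions integrated (Lebesgue on
`(ℝ²)^k`, the fixed position inserted at `j`); values in `ℝ≥0∞`.  The left-hand sides of (3.58)–(3.60) are this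
norm ("`Σ*` means that one of the sector indices is not summed over", `x⃗*` an arbitrary fixed point).  (The tree's
discrete `SectorisedKernelNorm.sectorisedKernelNorm` fixes sector and point of the SAME leg on a finite torus —
a different carrier; not restated.) [cite: BenfattoGiulianiMastropietro2003, §4.2 (5.3) p.21 (L89–93) and §2.7 (3.58)–(3.60) p.15 (L51–68)] -/
def mNorm (N : ℕ) {k : ℕ} (G : SectorKernel (k + 1)) : ℝ≥0∞ :=
  ⨆ (i : Fin (k + 1)), ⨆ (s : Fin N), ⨆ (j : Fin (k + 1)), ⨆ (y : Fin 2 → ℝ),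
    ∑ σ ∈ (Fintype.piFinset fun _ : Fin (k + 1) => Finset.range N).filter (fun σ => σ i = (s : ℕ)),
      ∫⁻ z : Fin k → (Fin 2 → ℝ), ‖G σ (Fin.insertNth j y z)‖ₑ

/-- **(5.3a)** the norm of a sequence `G = {G_h ∈ 𝓜_{h,p}, h_β ≤ h ≤ 1}`: `‖G‖_p = max_{h_β ≤ h ≤ 1} ‖G_h‖_{h,p}`.
[cite: BenfattoGiulianiMastropietro2003, §4.2 (5.3a) p.21 (L95–99)] -/
def seqNorm (hβ : ℤ) {k : ℕ} (G : ℤ → SectorKernel (k + 1)) : ℝ≥0∞ :=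
  ⨆ (h : ℤ) (_ : hβ ≤ h ∧ h ≤ 1), mNorm (numSectors h) (G h)

/-! ### Lemma 2.2 [lm3.2]: the hypotheses (3.58)–(3.60) and the bound (3.62) -/

/-- **(3.58)–(3.60), the hypotheses of Lemma 2.2 / Theorem 2.1 / Theorem 4.1 on the modified running coupling
functions** (p.15 L46–68), written with the norm (5.3) (the paper's identification, p.21 L82–87 and (5.6)): for
the carriers `Λ h = λ̃_h` (`σ`-components `λ̃_{h,σ}(x⃗₁,…,x⃗₄)`), `V h = ν̃_h`, `Z h = z̃_h`, at every scale
`h_β ≤ h ≤ 1` of the sequence (endpoints of scale `h_v` carry the MRCF of scale `h_v − 1`, p.14 L1–11):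
(3.58) `‖λ̃_h‖_{h,4} ≤ 2C₁|λ|γ^{-h/2}` (`γ^{-h/2} = 2^{-h}`), (3.59) `‖ν̃_h‖_{h,2} ≤ 2C₁C_ν|λ|`,
(3.60) `‖z̃_h‖_{h,2} ≤ C₁|λ|`.  A PREDICATE on the carriers (the MRCF themselves are gap objects, G-t3-03).
[cite: BenfattoGiulianiMastropietro2003, §2.7 Lemma 2.2 (3.58)–(3.60) p.15 (L46–68)] -/
def MRCFBounds (C₁ Cν lam : ℝ) (hβ : ℤ) (Λ : ℤ → SectorKernel 4) (V Z : ℤ → SectorKernel 2) : Prop :=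
  ∀ h : ℤ, hβ ≤ h → h ≤ 1 →
    mNorm (numSectors h) (Λ h) ≤ ENNReal.ofReal (2 * C₁ * |lam| * (2 : ℝ) ^ (-h)) ∧
    mNorm (numSectors h) (V h) ≤ ENNReal.ofReal (2 * C₁ * Cν * |lam|) ∧
    mNorm (numSectors h) (Z h) ≤ ENNReal.ofReal (C₁ * |lam|)

/-- **Lemma 2.2 [lm3.2], the bound (3.62) as a function of the skeleton** (`γ = 4`, root scale `h`, coupling `λ`):
`cⁿ|λ|ⁿ γ^{-½h[m₄(v₀) + 𝟙(P_{v₀}=∅)]} Π_{i=1}^n γ^{(h_i−1)𝟙(v*_i is of type ν)} Π_{v not e.p.} γ^{[−½m₄(v) + ½(|P_v|−3)𝟙(4≤|P_v|≤8) + ½(|P_v|−1)𝟙(|P_v|≥10)]}`.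

THE PRINTED LEMMA (p.15 L46–86), whose left-hand side is NOT typed here (gap G-t3-03): *Lemma 2.2. Suppose that
there exist two constants `C₁` and `C_ν` such that the modified coupling functions satisfy the following
conditions: i) if `|P_v| = 4`, then `Σ*_{σ ∈ O_{h_v−1}} ∫d(x⃗_v∖x⃗*) |λ̃_{h_v−1,σ}(x⃗_v)| ≤ 2C₁|λ|γ^{-½(h_v−1)}` (3.58),
where `Σ*` means that one of the sector indices is not summed over; ii) if `|P_v| = 2` and `x_v = (x₁, x₂)`, then
`Σ*_σ ∫dx⃗₁ |ν̃_{h_v−1,σ}(x⃗₁ − x⃗₂)| ≤ 2C₁C_ν|λ|` (3.59), `Σ*_σ ∫dx⃗₁ |z̃_{h_v−1,σ}(x⃗₁ − x⃗₂)| ≤ C₁|λ|` (3.60).  Consider a tree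
`τ ∈ 𝒯_{h,n}`, a graph `T ∈ 𝐓` and the corresponding tree graph `T*`, defined as after (3.54). Then
`Σ*_{Ω ∈ 𝒪_τ} [Π_{v∈τ} (χ_v(𝒮(P_v)) Π_{l∈T_v} δ_{ω_l⁺,ω_l⁻})] ∫ Π_{l∈T*∖T} dr_l |Π_{i=1}^n K̃^{h_i}_{v*_i,Ω̃_i}(x_{v*_i})| ≤`
the bound above (3.62), where `m₄(v)` denotes the number of endpoints of type `λ` following the vertex `v`.*
(`χ_v` = (3.44), `𝒮(P)` = (3.45a), `K̃` = (3.46), `dr_l` = (3.54).) [cite: BenfattoGiulianiMastropietro2003, §2.7 Lemma 2.2 (3.58)–(3.62) p.15 (L46–86)] -/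
def Tree.lemma22Bound (c lam : ℝ) (h : ℤ) (t : Tree) : ℝ :=
  c ^ t.numEndpoints * |lam| ^ t.numEndpoints *
    (4 : ℝ) ^ (-(1 / 2 * (h : ℝ) * ((t.m₄ : ℝ) + if t.extLegs = 0 then 1 else 0)) +
      t.endptExp {EndpointType.nu} (h + 1) + t.sectorVertexExp)

/-! ### Theorem 2.1 [th3.1] (3.69) and Theorem 4.1 [th5.1] (5.69): statement shapes -/

/-- **The right-hand side of (3.69)**: `(c|λ|)ⁿ γ^{h[−q₀ + δ_ext(2l₀)]}`, `γ = 4`. [cite: BenfattoGiulianiMastropietro2003, §2.7 Theorem 2.1 (3.69) p.16 (L35–40)] -/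
def theorem21Bound (c lam : ℝ) (h : ℤ) (n l₀ q₀ : ℕ) : ℝ :=
  (c * |lam|) ^ n * (4 : ℝ) ^ ((h : ℝ) * (-(q₀ : ℝ) + deltaExt (2 * l₀)))

/-- **BGM 2003 Theorem 2.1 [th3.1] — statement SHAPE on an explicit carrier.**  THE PRINTED THEOREM (p.16 L35–49):
*Theorem 2.1. If conditions (3.58), (3.59), (3.60) are satisfied, then `J_{h,n}(2l₀,q₀) ≤ (c|λ|)ⁿ γ^{h[−q₀ + δ_ext(2l₀)]}`
(3.69).*  Here `J_{h,n}(2l₀,q₀)` (3.48) — the sum over `τ ∈ 𝒯_{h,n}`, over `P` with `|P_{v₀}| = 2l₀`, over `T`,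
`α ∈ A_T` with `Σ_{f∈P_{v₀}} q_α(f) = q₀`, and over the sectors (one external sector fixed) weighted by
`Π_v χ_v(𝒮(P_v))`, of `∫d(x_{v₀}∖x*) |W^{(mod)}_{τ,P,Ω,T,α}(x_{v₀})|` — is a GAP object (G-t3-03) and enters as the
carrier `J h n l₀ q₀`; the hypotheses are `MRCFBounds` on the MRCF carriers; `h` ranges over the root scales
`h_β − 1 ≤ h ≤ 0` of (3.47).  (Remark p.16 L42–49: for `|λ|` small and `C_{1,2}|λ| log β ≤ 1` one can choose
`ν̃₁` so that the hypotheses hold — Theorem 4.2 — and then `lim_{L→∞} E_{L,β}` exists and is `O(λ)`.)  A PREDICATE: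
nothing is asserted. [cite: BenfattoGiulianiMastropietro2003, §2.7 Theorem 2.1 (3.69) p.16 (L35–49) and (3.47)–(3.48) p.14 (L50–70)] -/
def Theorem21Shape (c C₁ Cν lam : ℝ) (hβ : ℤ) (Λ : ℤ → SectorKernel 4) (V Z : ℤ → SectorKernel 2)
    (J : ℤ → ℕ → ℕ → ℕ → ℝ) : Prop :=
  MRCFBounds C₁ Cν lam hβ Λ V Z →
    ∀ (h : ℤ) (n l₀ q₀ : ℕ), hβ - 1 ≤ h → h ≤ 0 → 1 ≤ n → J h n l₀ q₀ ≤ theorem21Bound c lam h n l₀ q₀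

/-- **The right-hand side of (5.69)**: `(c|λ|)ⁿ γ^{h[δ_ext(p) − m]}`, `γ = 4`. [cite: BenfattoGiulianiMastropietro2003, §4.1 Theorem 4.1 (5.69) p.20 (L85–97)] -/
def theorem41Bound (c lam : ℝ) (h : ℤ) (n p m : ℕ) : ℝ :=
  (c * |lam|) ^ n * (4 : ℝ) ^ ((h : ℝ) * (deltaExt p - (m : ℝ)))

/-- **BGM 2003 Theorem 4.1 [th5.1] — statement SHAPE on an explicit carrier.**  THE PRINTED THEOREM (p.20 L85–101):
*Theorem 4.1. If conditions (3.58), (3.59), (3.60) are satisfied, given a couple of integers `(p,m)` equal to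
`(2,0)`, `(2,1)` or `(4,0)`, we have:
`Σ_{τ∈𝒯_{h,n}} Σ**_{P∈𝒫_τ: |P_{v₀}|=p, m(P_{v₀})=m} Σ_{T∈𝐓} Σ_{α∈A_T} Σ*_{Ω∈𝒪_τ} ∫d(x_{v₀}∖x*) |W^{(L,mod)}_{τ,P,Ω,T,α}(x_{v₀})| ≤ (c|λ|)ⁿ γ^{h[δ_ext(p)−m]}`
(5.69), with `δ_ext(p)` defined by (3.67a) and `Σ**` means that, if `n = 1` and `v*` is the endpoint,
`P_{v*} ≠ P_{v₀}`.*  ("We can repeat step by step the proof of Theorem 2.1 and use the remark that, in the identity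
(3.62b), `q₀ = m`.")  The left-hand side — built on the localised modified values `W^{(L,mod)}` of (5.0e) — is a GAP
object (G-t3-03) and enters as the carrier `JL h n p m`.  A PREDICATE: nothing is asserted.
[cite: BenfattoGiulianiMastropietro2003, §4.1 Theorem 4.1 (5.69) p.20 (L85–101)] -/
def Theorem41Shape (c C₁ Cν lam : ℝ) (hβ : ℤ) (Λ : ℤ → SectorKernel 4) (V Z : ℤ → SectorKernel 2)
    (JL : ℤ → ℕ → ℕ → ℕ → ℝ) : Prop :=
  MRCFBounds C₁ Cν lam hβ Λ V Z →
    ∀ (h : ℤ) (n : ℕ), hβ - 1 ≤ h → h ≤ 0 → 1 ≤ n →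
      JL h n 2 0 ≤ theorem41Bound c lam h n 2 0 ∧ JL h n 2 1 ≤ theorem41Bound c lam h n 2 1 ∧
        JL h n 4 0 ≤ theorem41Bound c lam h n 4 0

/-! ### §4.2: `h_β` (3.4a), Lemma 4.1 [lm5.1] and Theorem 4.2 [th5.2] (statement shapes) -/

/-- **(3.4a)** `h_β = max{h ≤ 0 : γ^{h−1}e₀ < π/β}` (`γ = 4`; `π/β` = the smallest fermionic Matsubara frequency,
so that `C₀⁻¹ = Σ_{h=h_β}^0 f_h` on `𝒟`, (3.4b)); in closed form `min(0, ⌈log_4(π/(βe₀))⌉)` — see `hBeta_spec`.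
`|h_β| ≍ log β`. [cite: BenfattoGiulianiMastropietro2003, §2.1 (3.4a)–(3.4b) p.6 (L94–100)] -/
def hBeta (β e₀ : ℝ) : ℤ := min 0 ⌈Real.logb 4 (π / (β * e₀))⌉

/-- `h_β ≤ 0`. [cite: BenfattoGiulianiMastropietro2003, §2.1 (3.4a) p.6 (L94–96)] -/
theorem hBeta_le_zero (β e₀ : ℝ) : hBeta β e₀ ≤ 0 := min_le_left _ _

/-- For `γ = 4 > 1`: `γ^{h−1}e₀ < π/β ↔ h − 1 < log_4(π/(βe₀))`. [cite: BenfattoGiulianiMastropietro2003, §2.1 (3.4a) p.6 (L94–96)] -/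
theorem zpow_mul_lt_iff {β e₀ : ℝ} (hβ : 0 < β) (he : 0 < e₀) (h : ℤ) :
    (4 : ℝ) ^ (h - 1) * e₀ < π / β ↔ ((h : ℝ) - 1) < Real.logb 4 (π / (β * e₀)) := by
  have hq : 0 < π / (β * e₀) := div_pos Real.pi_pos (mul_pos hβ he)
  rw [Real.lt_logb_iff_rpow_lt (by norm_num) hq, ← Real.rpow_intCast, Int.cast_sub, Int.cast_one,
    lt_div_iff₀ (mul_pos hβ he), lt_div_iff₀ hβ]
  constructor <;> intro H <;> nlinarith

/-- **`h_β` is the printed maximum**: for `β, e₀ > 0`, `γ^{h_β − 1}e₀ < π/β`, and every `h ≤ 0` with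
`γ^{h−1}e₀ < π/β` satisfies `h ≤ h_β`. [cite: BenfattoGiulianiMastropietro2003, §2.1 (3.4a) p.6 (L94–96)] -/
theorem hBeta_spec {β e₀ : ℝ} (hβ : 0 < β) (he : 0 < e₀) :
    (4 : ℝ) ^ (hBeta β e₀ - 1) * e₀ < π / β ∧
      ∀ h : ℤ, h ≤ 0 → (4 : ℝ) ^ (h - 1) * e₀ < π / β → h ≤ hBeta β e₀ := by
  have key := fun h : ℤ => zpow_mul_lt_iff hβ he h
  unfold hBeta
  set L := Real.logb 4 (π / (β * e₀)) with hL
  constructor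
  · rw [key]
    have h1 : ((min 0 ⌈L⌉ : ℤ) : ℝ) ≤ (⌈L⌉ : ℝ) := by exact_mod_cast (min_le_right (0 : ℤ) ⌈L⌉)
    have h2 : (⌈L⌉ : ℝ) < L + 1 := Int.ceil_lt_add_one L
    linarith
  · intro h hh0 hh
    rw [key] at hh
    refine le_min hh0 ?_
    have h3 : (h : ℝ) - 1 < (⌈L⌉ : ℝ) := lt_of_lt_of_le hh (Int.le_ceil L)
    have h4 : h - 1 < ⌈L⌉ := by exact_mod_cast h3
    omega

/-- **The right-hand side of (5.7)**: `max_{h<j≤1} ‖ν̃_j − ν̃'_j‖_{j,2}` (printed `max_{j>h} ‖ν̃_h − ν̃'_h‖_{h,2}`; read as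
in its proof (3.7d), p.22 L36–45). [cite: BenfattoGiulianiMastropietro2003, §4.2 Lemma 4.1 (5.7) p.21 (L129–133) and (3.7d) p.22 (L36–45)] -/
def supNormAbove (ν ν' : ℤ → SectorKernel 2) (h : ℤ) : ℝ≥0∞ :=
  ⨆ (j : ℤ) (_ : h < j ∧ j ≤ 1), mNorm (numSectors j) (ν j - ν' j)

/-- **BGM 2003 Lemma 4.1 [lm5.1] — statement SHAPE on explicit carriers.**  THE PRINTED LEMMA (p.21 L115–133):
*Lemma 4.1. There exist positive constants `C₁` and `C₂`, depending only on first and second order terms in our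
expansion, such that, given two positive constants `C₃ ≥ C₁` and `C₄`, there exists `λ₀` so that, if `|λ| ≤ λ₀`,
`2C₂C₃ max{1, C₄⁻¹} |λ||h_β| ≤ 1` and `‖ν̃‖₂, ‖ν̃'‖₂ ≤ C₃|λ|`, then, for `h_β ≤ h ≤ 1`,
`‖λ̃(ν̃)_h‖_{h,4} ≤ 2C₁|λ|γ^{-½h}`, `‖z̃(ν̃)_h‖_{h,2} ≤ C₁|λ|` (5.6),
`‖λ̃(ν̃)_h − λ̃(ν̃')_h‖_{h,4} ≤ C₄γ^{-½h} max_{j>h} ‖ν̃_j − ν̃'_j‖_{j,2}`, `‖z̃(ν̃)_h − z̃(ν̃')_h‖_{h,2} ≤ C₄ max_{j>h} ‖ν̃_j − ν̃'_j‖_{j,2}`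
(5.7).*  Here `ν̃, ν̃'` range over `𝔐₂` (sequences `{ν̃_h ∈ 𝓜_{h,2}, h_β ≤ h ≤ 1}` with finite `‖·‖₂`, (5.3a)), and
`λ̃(ν̃) ∈ 𝔐₄`, `z̃(ν̃) ∈ 𝔐₂` are THE SOLUTIONS of (5.5aa), (5.5ca) with `ν̃` as a parameter (p.21 L106–111) — GAP
objects (G-t3-03: they are built on the beta function `β^{p,m}_h` (5.2) and the envelopes `𝔉_{p,h,σ}` (3.45aa)),
entering as the carriers `LamOf λ h_β ν̃` and `ZOf λ h_β ν̃` (families in the coupling `λ` and in `h_β`, i.e. in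
`β`), while membership in `𝔐₂` is the explicit predicate `mem h_β`.  (5.7)'s `max_{j>h}` is read as in its proof
(3.7d): over `h < j ≤ 1`.  `γ^{-½h} = 2^{-h}`.  A PREDICATE: nothing is asserted. [cite: BenfattoGiulianiMastropietro2003, §4.2 Lemma 4.1 (5.6)–(5.7) p.21 (L106–133)] -/
def Lemma41Shape (mem : ℤ → (ℤ → SectorKernel 2) → Prop)
    (LamOf : ℝ → ℤ → (ℤ → SectorKernel 2) → ℤ → SectorKernel 4)
    (ZOf : ℝ → ℤ → (ℤ → SectorKernel 2) → ℤ → SectorKernel 2) : Prop :=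
  ∃ C₁ C₂ : ℝ, 0 < C₁ ∧ 0 < C₂ ∧ ∀ C₃ C₄ : ℝ, C₁ ≤ C₃ → 0 < C₄ →
    ∃ lam₀ : ℝ, 0 < lam₀ ∧ ∀ (lam : ℝ) (hβ : ℤ), |lam| ≤ lam₀ → hβ ≤ 0 →
      2 * C₂ * C₃ * max 1 C₄⁻¹ * |lam| * |(hβ : ℝ)| ≤ 1 →
        ∀ ν ν' : ℤ → SectorKernel 2, mem hβ ν → mem hβ ν' →
          seqNorm hβ ν ≤ ENNReal.ofReal (C₃ * |lam|) → seqNorm hβ ν' ≤ ENNReal.ofReal (C₃ * |lam|) →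
            ∀ h : ℤ, hβ ≤ h → h ≤ 1 →
              mNorm (numSectors h) (LamOf lam hβ ν h) ≤ ENNReal.ofReal (2 * C₁ * |lam| * (2 : ℝ) ^ (-h)) ∧
              mNorm (numSectors h) (ZOf lam hβ ν h) ≤ ENNReal.ofReal (C₁ * |lam|) ∧
              mNorm (numSectors h) (LamOf lam hβ ν h - LamOf lam hβ ν' h) ≤
                ENNReal.ofReal (C₄ * (2 : ℝ) ^ (-h)) * supNormAbove ν ν' h ∧
              mNorm (numSectors h) (ZOf lam hβ ν h - ZOf lam hβ ν' h) ≤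
                ENNReal.ofReal C₄ * supNormAbove ν ν' h

/-- **BGM 2003 Theorem 4.2 [th5.2] — statement SHAPE on an explicit carrier.**  THE PRINTED THEOREM (p.22 L59–64):
*Theorem 4.2. If `|λ|` is small enough and `C_{1,2} log β |λ| ≤ 1`, where `C_{1,2}` is a constant depending only
on first and second order contributions of perturbation theory, it is possible to choose `ν̃₁(x⃗)` so that the MRCF
satisfy the hypothesis of Lemma 2.2, (3.58), (3.59) and (3.60).*  (Proof: a fixed point of `𝐓 : 𝔐₂ → 𝔐₂` (5.8)
in the ball `‖ν̃‖₂ ≤ 2C₁C_ν|λ|`, using Theorem 4.1 and Lemma 4.1.)  The MRCF `(λ̃, ν̃, z̃)` generated by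
(5.5aa)–(5.5ca) from the initial datum `ν̃₁` at coupling `λ` and inverse temperature `β` are GAP objects (G-t3-03)
and enter as the carrier `MRCF λ β ν̃₁`; admissibility of the datum (`ν̃₁ ∈ 𝓜_{1,2}`, p.21 L19–21) is the explicit
predicate `mem₁`; `h_β = hBeta β e₀` (3.4a); the constants `C₁, C_ν` of (3.58)–(3.60) are those of Lemma 4.1 and
of the proof (p.22 L79–103), independent of `λ, β`.  A PREDICATE: nothing is asserted.
[cite: BenfattoGiulianiMastropietro2003, §4.2 Theorem 4.2 p.22 (L59–118)] -/
def Theorem42Shape (e₀ : ℝ) (mem₁ : SectorKernel 2 → Prop)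
    (MRCF : ℝ → ℝ → SectorKernel 2 →
      (ℤ → SectorKernel 4) × (ℤ → SectorKernel 2) × (ℤ → SectorKernel 2)) : Prop :=
  ∃ lam₀ C₁₂ C₁ Cν : ℝ, 0 < lam₀ ∧ 0 < C₁₂ ∧ 0 < C₁ ∧ 0 < Cν ∧
    ∀ lam β : ℝ, |lam| ≤ lam₀ → 0 < β → C₁₂ * Real.log β * |lam| ≤ 1 →
      ∃ ν₁ : SectorKernel 2, mem₁ ν₁ ∧
        MRCFBounds C₁ Cν lam (hBeta β e₀) (MRCF lam β ν₁).1 (MRCF lam β ν₁).2.1 (MRCF lam β ν₁).2.2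

/-! ### Non-vacuity of the skeleton -/

/-- The tree of Fig. 1's kind with `v₀` carrying `|P_{v₀}| = 2` and two endpoints, of types `λ` and `ν`:
`n = 2`, `m₄(v₀) = m₂(v₀) = 1`, `s_{v₀} = 2`. [cite: BenfattoGiulianiMastropietro2003, §2.4 Fig. 1 p.8 (L86–91)] -/
def Tree.exampleTwoLeg : Tree := .vtx 2 (.cons (.endpt .lam) (.cons (.endpt .nu) .nil))

/-- Its power counting: the (3.66a) exponents with `q₀ = 0` sum to `h·δ_ext(2) + δ(2) = h − 1`. [cite: BenfattoGiulianiMastropietro2003, §2.7 (3.66)–(3.67a) p.16 (L9–21)] -/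
theorem Tree.exampleTwoLeg_powerCounting (h : ℤ) :
    (h : ℝ) * (deltaExt 2 - ((0 : ℕ) : ℝ)) + Tree.exampleTwoLeg.deltaSum + (if (2 : ℕ) = 0 then 5 / 2 else 0) =
      (h : ℝ) - 1 := by
  simp only [Tree.exampleTwoLeg, Tree.deltaSum, Forest.deltaSum, deltaExt, delta, Nat.cast_zero,
    Nat.cast_ofNat]
  norm_num
  ring

end BGM2003

end Literature.MathematicalPhysics.QuantumLattice.FermiRG

end
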